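import Summits.AtomisticToContinuum.FouriersLaw.Theorems.BondHeatUncertaintyBoundedResponseEscapeExcessA

/-!
# NODE 93 «EscapeExcess» (lens-1 g93) beneath 11071 — part 2 of 2 (sequel of `…BondHeatUncertaintyBoundedResponseEscapeExcessA`)

Split for the 400-line cap by the landing lane (hand-2 g35); the module docstring of part 1 (`…BondHeatUncertaintyBoundedResponseEscapeExcessA`) describes the whole node.  Same namespace; all FQNs unchanged.
0 sorry; standard axioms.
-/

noncomputable section
open MeasureTheory Filter Topology Set intervalIntegral
open scoped BigOperators

namespace Summit.AtomisticToContinuum.FouriersLaw.Theorems.SubdiffusiveBondHeat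

namespace EscapeGrading

open Literature.MathematicalPhysics.KineticTheory.HeatConduction
open Summit.AtomisticToContinuum.FouriersLaw.Theses.BondHeatUncertainty
  (BoundedResponse NonBallistic LightConeBondHeat ExtensiveSnapshotIrreversibility LinearResponseFTUR NessUnique)
open Summit.AtomisticToContinuum.FouriersLaw.Theses.ChannelExclusionTauberian (NoBallisticChannel NoAnomalousChannel)
open Summit.AtomisticToContinuum.FouriersLaw.Theses.OddSectorIrreversibility (ConeScaleCorrector)

/-! ## 6. The local seam: the one-step increment law telescopes to X -/

/-- `1/m² ≤ 1/(m−1) − 1/m` for `m ≥ 2` (real form). [folklore] -/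
theorem one_div_sq_le_sub {m : ℝ} (hm : 2 ≤ m) : 1 / m ^ 2 ≤ 1 / (m - 1) - 1 / m := by
  have hm0 : 0 < m := by linarith
  have hm1 : 0 < m - 1 := by linarith
  have hid : 1 / (m - 1) - 1 / m = 1 / ((m - 1) * m) := by
    field_simp
    ring
  rw [hid]
  exact one_div_le_one_div_of_le (by positivity) (by nlinarith)

/-- **Telescoping: `EscapeIncrementLaw ⟹ EscapeExcessLaw`** with constant `2·max C 0`:
`E_N ≤ E_M + c·Σ_{m=N}^{M−1} 1/m² ≤ E_M + c(1/(N−1) − 1/(M−1)) ≤ E_M + 2c/N` (`N ≥ 2`). [kernel · frame] -/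
theorem escapeExcessLaw_of_incrementLaw (hI : EscapeIncrementLaw) : EscapeExcessLaw := by
  intro ω₂ lam β γ hω hl hβ hγ T hT
  obtain ⟨C, N₀, hC⟩ := hI ω₂ lam β γ hω hl hβ hγ T hT
  set c : ℝ := max C 0 with hc
  have hc0 : 0 ≤ c := le_max_right _ _
  refine ⟨2 * c, max N₀ 2, fun N hN M hM => ?_⟩
  have hN₀ : N₀ ≤ N := le_trans (le_max_left _ _) hN
  have hN2 : 2 ≤ N := le_trans (le_max_right _ _) hN
  have hN2r : (2 : ℝ) ≤ (N : ℝ) := by exact_mod_cast hN2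
  -- telescoped bound with the exact partial sums of `1/((m-1)m)`
  have key : ∀ M : ℕ, N ≤ M → escapeDeficit ω₂ lam β γ T N ≤
      escapeDeficit ω₂ lam β γ T M + c * (1 / ((N : ℝ) - 1) - 1 / ((M : ℝ) - 1)) := by
    intro M hM
    induction M, hM using Nat.le_induction with
    | base => simp
    | succ M hNM ih =>
      have hM2r : (2 : ℝ) ≤ (M : ℝ) := by exact_mod_cast le_trans hN2 hNM
      have hMsq : (0 : ℝ) < (M : ℝ) ^ 2 := by positivity
      have hstep : escapeDeficit ω₂ lam β γ T M ≤ escapeDeficit ω₂ lam β γ T (M + 1) + c / (M : ℝ) ^ 2 := by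
        have h1 := hC M (le_trans hN₀ hNM)
        have h2 : C / (M : ℝ) ^ 2 ≤ c / (M : ℝ) ^ 2 := div_le_div_of_nonneg_right (le_max_left C 0) hMsq.le
        linarith
      have hcast : (((M + 1 : ℕ) : ℝ)) - 1 = (M : ℝ) := by push_cast; ring
      have hinv : 1 / (M : ℝ) ^ 2 ≤ 1 / ((M : ℝ) - 1) - 1 / ((((M + 1 : ℕ) : ℝ)) - 1) := by
        rw [hcast]; exact one_div_sq_le_sub hM2r
      have hcm : c / (M : ℝ) ^ 2 ≤ c * (1 / ((M : ℝ) - 1) - 1 / ((((M + 1 : ℕ) : ℝ)) - 1)) := by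
        calc c / (M : ℝ) ^ 2 = c * (1 / (M : ℝ) ^ 2) := by rw [mul_one_div]
          _ ≤ _ := mul_le_mul_of_nonneg_left hinv hc0
      calc escapeDeficit ω₂ lam β γ T N
          ≤ escapeDeficit ω₂ lam β γ T M + c * (1 / ((N : ℝ) - 1) - 1 / ((M : ℝ) - 1)) := ih
        _ ≤ escapeDeficit ω₂ lam β γ T (M + 1) + c / (M : ℝ) ^ 2 + c * (1 / ((N : ℝ) - 1) - 1 / ((M : ℝ) - 1)) := by
            linarith
        _ ≤ escapeDeficit ω₂ lam β γ T (M + 1) + c * (1 / ((N : ℝ) - 1) - 1 / ((((M + 1 : ℕ) : ℝ)) - 1)) := by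
            linarith
  have hM2r : (2 : ℝ) ≤ (M : ℝ) := by exact_mod_cast le_trans hN2 hM
  have hM1 : 0 < (M : ℝ) - 1 := by linarith
  have hN1 : 0 < (N : ℝ) - 1 := by linarith
  have hNpos : 0 < (N : ℝ) := by linarith
  have h1 : 1 / ((N : ℝ) - 1) ≤ 2 / (N : ℝ) := by
    rw [div_le_iff₀ hN1, div_mul_eq_mul_div, le_div_iff₀ hNpos]
    linarith
  have h2 : 0 ≤ 1 / ((M : ℝ) - 1) := by positivity
  have hfin : c * (1 / ((N : ℝ) - 1) - 1 / ((M : ℝ) - 1)) ≤ 2 * c / (N : ℝ) := by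
    calc c * (1 / ((N : ℝ) - 1) - 1 / ((M : ℝ) - 1)) ≤ c * (2 / (N : ℝ)) := by nlinarith
      _ = 2 * c / (N : ℝ) := by ring
  linarith [key M hM]

/-- `EscapeIncrementLaw → NonBallistic → BoundedResponse`. [kernel · frame] -/
theorem boundedResponse_of_incrementLaw_of_nonBallistic (hI : EscapeIncrementLaw) (hB : NonBallistic) : BoundedResponse :=
  boundedResponse_of_escapeExcessLaw_of_nonBallistic (escapeExcessLaw_of_incrementLaw hI) hB

/-! ## 7. X forces convergence of the ballistic fraction: the dichotomy «Ohmic or uniformly ballistic» -/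

/-- **A bounded real sequence whose drops are eventually small converges**: if `|E n| ≤ B` and for every `ε > 0` eventually
`E N ≤ E M + ε` for all `M ≥ N`, then `E` converges. [kernel] -/
theorem tendsto_of_bounded_of_smallDrops {E : ℕ → ℝ} {B : ℝ} (hB : ∀ n : ℕ, |E n| ≤ B)
    (hX : ∀ ε : ℝ, 0 < ε → ∃ N₀ : ℕ, ∀ N : ℕ, N₀ ≤ N → ∀ M : ℕ, N ≤ M → E N ≤ E M + ε) :
    ∃ L : ℝ, Tendsto E atTop (𝓝 L) := by
  refine cauchySeq_tendsto_of_complete (Metric.cauchySeq_iff'.2 fun ε hε => ?_)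
  obtain ⟨N₀, hN₀⟩ := hX (ε / 4) (by positivity)
  -- the tail supremum
  set S : Set ℝ := (fun n : ℕ => E n) '' {n : ℕ | N₀ ≤ n} with hS
  have hSne : S.Nonempty := ⟨E N₀, ⟨N₀, (le_refl N₀ : N₀ ≤ N₀), rfl⟩⟩
  have hSbdd : BddAbove S := ⟨B, by rintro x ⟨n, -, rfl⟩; exact le_trans (le_abs_self _) (hB n)⟩
  set s : ℝ := sSup S with hs
  have hle : ∀ n : ℕ, N₀ ≤ n → E n ≤ s := fun n hn => le_csSup hSbdd ⟨n, hn, rfl⟩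
  obtain ⟨x, ⟨N₁, hN₁, rfl⟩, hx⟩ := exists_lt_of_lt_csSup hSne (by linarith : s - ε / 4 < s)
  refine ⟨N₁, fun n hn => ?_⟩
  have h1 : E N₁ ≤ E n + ε / 4 := hN₀ N₁ hN₁ n hn
  have h2 : E n ≤ s := hle n (le_trans hN₁ hn)
  have h3 : E N₁ ≤ s := hle N₁ hN₁
  rw [Real.dist_eq, abs_lt]
  constructor <;> linarith

/-- **`EscapeExcess a`, `a > 0` ⟹ the ballistic fraction `E_N(T)` CONVERGES** at every temperature (to some `E_∞(T) ∈ [0, 1]`). [kernel · frame] -/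
theorem tendsto_escapeDeficit_of_escapeExcess {a : ℝ} (ha : 0 < a) (hX : EscapeExcess a) {ω₂ lam β γ : ℝ} (hω : 0 < ω₂)
    (hl : 0 < lam) (hβ : 0 < β) (hγ : 0 < γ) {T : ℝ} (hT : 0 < T) :
    ∃ L : ℝ, 0 ≤ L ∧ L ≤ 1 ∧ Tendsto (fun N : ℕ => escapeDeficit ω₂ lam β γ T N) atTop (𝓝 L) := by
  obtain ⟨C, N₀, hC⟩ := hX ω₂ lam β γ hω hl hβ hγ T hT
  -- work with the shifted sequence `n ↦ E_{n+2}` (nonnegative, ≤ 1)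
  set F : ℕ → ℝ := fun n => escapeDeficit ω₂ lam β γ T (n + 2) with hF
  have hF0 : ∀ n, 0 ≤ F n := fun n => escapeDeficit_nonneg' hω hl hβ hγ hT (by omega)
  have hF1 : ∀ n, F n ≤ 1 := fun n => escapeDeficit_le_one ω₂ lam β γ hω hl hβ hγ T hT (n + 2)
  have hFb : ∀ n, |F n| ≤ 1 := fun n => by rw [abs_of_nonneg (hF0 n)]; exact hF1 n
  have hdrop : ∀ ε : ℝ, 0 < ε → ∃ N₁ : ℕ, ∀ N : ℕ, N₁ ≤ N → ∀ M : ℕ, N ≤ M → F N ≤ F M + ε := by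
    intro ε hε
    -- `max C 0 / (N+2)^a ≤ ε` eventually since `(N+2)^a → ∞`
    have hlim : Tendsto (fun N : ℕ => max C 0 / ((N : ℝ) + 2) ^ a) atTop (𝓝 0) := by
      have h1 : Tendsto (fun N : ℕ => ((N : ℝ) + 2) ^ a) atTop atTop :=
        (tendsto_rpow_atTop ha).comp (tendsto_natCast_atTop_atTop.atTop_add tendsto_const_nhds)
      exact h1.const_div_atTop (max C 0) |>.congr fun _ => rfl
    obtain ⟨N₁, hN₁⟩ := eventually_atTop.1 (hlim.eventually (ge_mem_nhds hε))
    refine ⟨max N₀ N₁, fun N hN M hM => ?_⟩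
    have hNN : N₀ ≤ N + 2 := by omega
    have h := hC (N + 2) hNN (M + 2) (by omega)
    have hpos : (0 : ℝ) < ((N : ℝ) + 2) ^ a := Real.rpow_pos_of_pos (by positivity) a
    have hcast : (((N + 2 : ℕ) : ℝ)) = (N : ℝ) + 2 := by push_cast; ring
    have hCle : C / (((N + 2 : ℕ) : ℝ)) ^ a ≤ max C 0 / ((N : ℝ) + 2) ^ a := by
      rw [hcast]; exact div_le_div_of_nonneg_right (le_max_left C 0) hpos.le
    have hε' := hN₁ N (le_trans (le_max_right _ _) hN)
    show escapeDeficit ω₂ lam β γ T (N + 2) ≤ escapeDeficit ω₂ lam β γ T (M + 2) + ε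
    linarith
  obtain ⟨L, hL⟩ := tendsto_of_bounded_of_smallDrops hFb hdrop
  have hL0 : 0 ≤ L := ge_of_tendsto' hL hF0
  have hL1 : L ≤ 1 := le_of_tendsto' hL hF1
  refine ⟨L, hL0, hL1, ?_⟩
  -- unshift
  exact (tendsto_add_atTop_iff_nat 2).1 hL

/-- **DICHOTOMY per temperature under X**: either the Ohmic floor holds at `T` (`E_N(T) ≤ C₁/N` eventually), or the ballistic fraction
converges to a POSITIVE limit (`E_N(T) → E_∞(T) > 0`: uniformly ballistic, `D_N ≥ (N−1)γE_∞/2` eventually).  No anomalous exponent and no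
oscillation between the two is compatible with X. [kernel · frame] -/
theorem ohmicAt_or_ballistic_of_escapeExcess {a : ℝ} (ha : 0 < a) (hX : EscapeExcess a) {ω₂ lam β γ : ℝ}
    (hω : 0 < ω₂) (hl : 0 < lam) (hβ : 0 < β) (hγ : 0 < γ) {T : ℝ} (hT : 0 < T) :
    (∃ C₁ : ℝ, ∃ N₀ : ℕ, ∀ N : ℕ, N₀ ≤ N → escapeDeficit ω₂ lam β γ T N ≤ C₁ / (N : ℝ) ^ a) ∨
    (∃ L : ℝ, 0 < L ∧ Tendsto (fun N : ℕ => escapeDeficit ω₂ lam β γ T N) atTop (𝓝 L)) := by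
  obtain ⟨L, hL0, -, hL⟩ := tendsto_escapeDeficit_of_escapeExcess ha hX hω hl hβ hγ hT
  rcases hL0.lt_or_eq with hpos | hzero
  · exact Or.inr ⟨L, hpos, hL⟩
  · left
    obtain ⟨C, N₀, hC⟩ := hX ω₂ lam β γ hω hl hβ hγ T hT
    rw [← hzero] at hL
    exact ⟨C, N₀, fun N hN => le_of_excess_of_frequently_small (hC N hN) fun ε hε => exists_le_of_tendsto_zero hL ε hε N⟩

/-! ## 7b. Finite-size scaling of the ballistic fraction: `EscapeLimitRate ⟹ X ⟹ (limit + one-sided rate)` -/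

/-- **Finite-size scaling law for the ballistic fraction** [route statement · this cell; NOT a literature fact]: at every temperature the
escape deficit has a limit `E_∞(T)` with `|E_N(T) − E_∞(T)| ≤ C/N` eventually.  Meaningful in BOTH phases (`E_∞ > 0` ballistic,
`E_∞ = 0` Ohmic); STRONGER than X (two-sided), FL-NECESSARY (`L = 0`); `BoundedResponse ⟺ NonBallistic ∧ EscapeLimitRate`.
Why it might fail: a lower deviation `E_∞ − E_N ≫ 1/N` (slow approach from BELOW) at some `(params, T)`; the harmonic rate is exponential. -/
def EscapeLimitRate : Prop :=
  ∀ ω₂ lam β γ : ℝ, 0 < ω₂ → 0 < lam → 0 < β → 0 < γ → ∀ T : ℝ, 0 < T →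
    ∃ L C : ℝ, ∃ N₀ : ℕ, ∀ N : ℕ, N₀ ≤ N → |escapeDeficit ω₂ lam β γ T N - L| ≤ C / (N : ℝ)

/-- **`EscapeLimitRate ⟹ EscapeExcessLaw`** (`E_N ≤ L + C/N`, `E_M ≥ L − C/M ≥ L − C/N`). [folklore] -/
theorem escapeExcessLaw_of_escapeLimitRate (h : EscapeLimitRate) : EscapeExcessLaw := by
  intro ω₂ lam β γ hω hl hβ hγ T hT
  obtain ⟨L, C, N₀, hC⟩ := h ω₂ lam β γ hω hl hβ hγ T hT
  refine ⟨2 * max C 0, max N₀ 1, fun N hN M hM => ?_⟩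
  have hN1 : (1 : ℝ) ≤ (N : ℝ) := by exact_mod_cast le_trans (le_max_right _ _) hN
  have hNpos : (0 : ℝ) < (N : ℝ) := by linarith
  have hNM : (N : ℝ) ≤ (M : ℝ) := by exact_mod_cast hM
  have hMpos : (0 : ℝ) < (M : ℝ) := by linarith
  have h1 := abs_le.1 (hC N (le_trans (le_max_left _ _) hN))
  have h2 := abs_le.1 (hC M (le_trans (le_trans (le_max_left _ _) hN) hM))
  have hc1 : C / (N : ℝ) ≤ max C 0 / (N : ℝ) := div_le_div_of_nonneg_right (le_max_left _ _) hNpos.le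
  have hc2 : C / (M : ℝ) ≤ max C 0 / (M : ℝ) := div_le_div_of_nonneg_right (le_max_left _ _) hMpos.le
  have hc3 : max C 0 / (M : ℝ) ≤ max C 0 / (N : ℝ) := div_le_div_of_nonneg_left (le_max_right _ _) hNpos hNM
  have hsplit : 2 * max C 0 / (N : ℝ) = max C 0 / (N : ℝ) + max C 0 / (N : ℝ) := by ring
  linarith [h1.2, h2.1]

/-- **`EscapeLimitRate` is FL-NECESSARY** (`L = 0`, `0 ≤ E_N ≤ C₁/N`). [folklore] -/
theorem escapeLimitRate_of_boundedResponse (h : BoundedResponse) : EscapeLimitRate := by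
  intro ω₂ lam β γ hω hl hβ hγ T hT
  obtain ⟨C, N₀, hC⟩ := (ohmicFloor_iff_boundedResponse.2 h) ω₂ lam β γ hω hl hβ hγ T hT
  refine ⟨0, C, max N₀ 2, fun N hN => ?_⟩
  have h0 : 0 ≤ escapeDeficit ω₂ lam β γ T N := escapeDeficit_nonneg' hω hl hβ hγ hT (le_trans (le_max_right _ _) hN)
  rw [sub_zero, abs_of_nonneg h0]
  exact hC N (le_trans (le_max_left _ _) hN)

/-- **`BoundedResponse ⟺ NonBallistic ∧ EscapeLimitRate`** — «not uniformly ballistic» ∧ «1/N finite-size scaling of the ballistic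
fraction». [folklore] -/
theorem boundedResponse_iff_nonBallistic_and_limitRate : BoundedResponse ↔ NonBallistic ∧ EscapeLimitRate :=
  ⟨fun h => ⟨nonBallistic_of_boundedResponse h, escapeLimitRate_of_boundedResponse h⟩,
   fun h => boundedResponse_of_escapeExcessLaw_of_nonBallistic (escapeExcessLaw_of_escapeLimitRate h.2) h.1⟩

/-- **X ⟹ limit + ONE-SIDED rate**: under `EscapeExcessLaw`, at every temperature `E_N(T) → E_∞(T)` and `E_N(T) ≤ E_∞(T) + C/N`
beyond `N₀` (let `M → ∞` in X).  The approach from below is not controlled by X. [kernel · frame] -/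
theorem upperRate_of_escapeExcessLaw (hX : EscapeExcessLaw) {ω₂ lam β γ : ℝ} (hω : 0 < ω₂) (hl : 0 < lam) (hβ : 0 < β)
    (hγ : 0 < γ) {T : ℝ} (hT : 0 < T) :
    ∃ L C : ℝ, ∃ N₀ : ℕ, Tendsto (fun N : ℕ => escapeDeficit ω₂ lam β γ T N) atTop (𝓝 L) ∧
      ∀ N : ℕ, N₀ ≤ N → escapeDeficit ω₂ lam β γ T N ≤ L + C / (N : ℝ) := by
  obtain ⟨L, -, -, hL⟩ := tendsto_escapeDeficit_of_escapeExcess one_pos (escapeExcess_one_iff_law.2 hX) hω hl hβ hγ hT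
  obtain ⟨C, N₀, hC⟩ := hX ω₂ lam β γ hω hl hβ hγ T hT
  refine ⟨L, C, N₀, hL, fun N hN => ?_⟩
  have hev : ∀ᶠ M in atTop, escapeDeficit ω₂ lam β γ T N - C / (N : ℝ) ≤ escapeDeficit ω₂ lam β γ T M := by
    filter_upwards [eventually_ge_atTop N] with M hM
    linarith [hC N hN M hM]
  have hlim : escapeDeficit ω₂ lam β γ T N - C / (N : ℝ) ≤ L := ge_of_tendsto hL hev
  linarith

/-! ## 8. The harmonic member: instrument certificate and the separation X ⇏ 11071 -/

/-- **Harmonic excess certificate** (purely harmonic pinned chain `λ = β = 0`, `T = 1`; the Gaussian deficit is temperature independent)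
[route statement · this cell; NOT a literature fact]: `E_N^{harm} ≤ E_M^{harm} + C/N` for `N₀ ≤ N ≤ M`.  ATTACKABLE (exact Gaussian
transmission formula; numerically `E_N^{harm}` decreases monotonically to `E_∞ = 1/8` at `ω₂ = γ = 1`: `0.1364, 0.1279, 0.1252, 0.1250,
…`, cell g92/g93 numerics), and together with `HarmonicEscapeFloor` (`E_N^{harm} ≥ e > 0`, whence the harmonic Ohmic floor FAILS:
`not_harmonicOhmicFloor_of_harmonicEscapeFloor`) it exhibits the excess law holding where bounded response fails. [certificate · aside] -/
def HarmonicEscapeExcess : Prop :=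
  ∀ ω₂ γ : ℝ, 0 < ω₂ → 0 < γ →
    ∃ C : ℝ, ∃ N₀ : ℕ, ∀ N : ℕ, N₀ ≤ N → ∀ M : ℕ, N ≤ M →
      escapeDeficit ω₂ 0 0 γ 1 N ≤ escapeDeficit ω₂ 0 0 γ 1 M + C / (N : ℝ)

/-- **The harmonic Ohmic floor fails given the harmonic escape floor** (`E_N^{harm} ≥ e > 0` eventually is incompatible with
`E_N^{harm} ≤ C/N` eventually). [folklore] -/
theorem not_harmonicOhmicFloor_of_harmonicEscapeFloor (hF : HarmonicEscapeFloor) :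
    ¬ (∀ ω₂ γ : ℝ, 0 < ω₂ → 0 < γ → ∃ C : ℝ, ∃ N₀ : ℕ, ∀ N : ℕ, N₀ ≤ N →
        escapeDeficit ω₂ 0 0 γ 1 N ≤ C / (N : ℝ)) := by
  intro hO
  obtain ⟨e, he, N₀, hN₀⟩ := hF 1 1 one_pos one_pos
  obtain ⟨C, N₁, hC⟩ := hO 1 1 one_pos one_pos
  obtain ⟨K, hK⟩ := exists_nat_gt (C / e)
  set N : ℕ := max (max N₀ N₁) (max K 1) with hN
  have hNK : K ≤ N := le_trans (le_max_left _ _) (le_max_right _ _)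
  have hN1 : 1 ≤ N := le_trans (le_max_right _ _) (le_max_right _ _)
  have hNpos : (0 : ℝ) < (N : ℝ) := by exact_mod_cast lt_of_lt_of_le zero_lt_one hN1
  have hKr : (K : ℝ) ≤ (N : ℝ) := by exact_mod_cast hNK
  have h1 := hN₀ N (le_trans (le_max_left _ _) (le_max_left _ _))
  have h2 := hC N (le_trans (le_max_right _ _) (le_max_left _ _))
  have h3 : C / (N : ℝ) < e := by
    rw [div_lt_iff₀ hNpos]
    have := (div_lt_iff₀ he).1 (lt_of_lt_of_le hK hKr)
    linarith
  linarith

end EscapeGrading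

end Summit.AtomisticToContinuum.FouriersLaw.Theorems.SubdiffusiveBondHeat

end
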